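import Literature.AlgebraicGeometry.HodgeTheory.WeilClassTestTensorPointRing
import HarnessLib

/-!
# The Néron–Severi ring of the tensor point `A₀ × A₀`, II: independence — `Sym³ NS_ℚ ↪ H⁶(Y₀; ℚ)` has rank 10, and the
# Hilbert function of `ℚ[θ₁, θ₂, P] ⊂ H^{2•}(Y₀; ℚ)` is exactly `(1, 3, 6, 10, 6, 3, 1)`

Family `hodge`, layer `Literature/AlgebraicGeometry/HodgeTheory`. Fully PROVED statements (no named fact, no definition),
continuing `WeilClassTestTensorPointRing.lean` (dictionary (T)(B)(I)(G) there; same hypotheses: elements `a b c : Fin 3 → A`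
of a commutative ring with the fifteen block relations `h`). Here the scalars come from a field `F` of characteristic `0` and
`A` is an `F`-algebra with `vol = a₁b₁a₂b₂a₃b₃ ≠ 0` — as for `A = H^{ev}(Y₀; F)`, `F ⊇ ℚ` — and we prove the LOWER bounds
of the Hilbert function: the listed monomials are linearly independent over `F`. Method: `q • vol = 0 ⇒ q = 0`; multiplying a
vanishing combination by each monomial of complementary degree and using the intersection table (§4 of the first file) gives
a linear system for the coefficients whose (Gram) matrix is non-singular — block-diagonal for the grading
`deg_{θ₁} − deg_{θ₂}`, with blocks such as `[[−720, 72], [72, −24]]` (`P³, θ₁θ₂P`) and `[[72, −24], [−24, 36]]`. With the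
UPPER bounds (the quartic relations and quintic reductions of the first file, and its §4: every sextic monomial is a multiple
of `vol`) this gives `dim Sub_k = 1, 3, 6, 10, 6, 3, 1` exactly, and the pairings `Sub_k × Sub_{6−k} → F·vol` are perfect.
The degree-3 statement is the exact-rank input "(T) `Sym³NS ≅ B³` (`dim = 10`)" of `WeilClassTestSplitDesigns.lean` /
`WeilClassTestPairedDesign.lean` (there from the script `tensor_point_cubic.py`), now a kernel theorem for every `d`; the
degree-4 statement (`6`, not `15`) is what the companion file `WeilClassTestTensorPointWeilFrame.lean` turns into the five
degree-4 purity functionals. Not a case of the Hodge conjecture; closes no rung (packet `run/shared/lean/b2b/hodge-weil/`,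
LADDER C63 row pv3-g6).
-/

namespace Literature.AlgebraicGeometry.HodgeTheory.WeilClassTestTensorPointRingRank

open Literature.AlgebraicGeometry.HodgeTheory.WeilClassTestTensorPointRing

section Rank

variable {A : Type*} [CommRing A] (a b c : Fin 3 → A)

local notation3 "ϑ₁" => a 0 + a 1 + a 2
local notation3 "ϑ₂" => b 0 + b 1 + b 2
local notation3 "𝒫" => c 0 + c 1 + c 2
local notation3 "vol" => a 0 * b 0 * a 1 * b 1 * a 2 * b 2
local notation3 "BlockRel" => (∀ i, a i * a i = 0) ∧ (∀ i, b i * b i = 0) ∧ (∀ i, a i * c i = 0) ∧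
  (∀ i, b i * c i = 0) ∧ (∀ i, c i * c i = -(2 * (a i * b i)))

/-- In an algebra over a field, a scalar multiple `q·v` (written `algebraMap q * v`) of a non-zero element `v` vanishes
only for `q = 0`. [folklore] -/
theorem smul_vol_eq_zero {F : Type*} [Field F] [Algebra F A] {v : A} (hv : v ≠ 0) (q : F)
    (hq : algebraMap F A q * v = 0) : q = 0 := by
  by_contra hne
  exact hv (((IsUnit.mk0 q hne).map (algebraMap F A)).mul_right_eq_zero.mp hq)

/-- Abstract form of `sextic_independent` (next): elements `T₁, T₂, Q, v ≠ 0` of a commutative algebra over a field of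
characteristic `0` satisfying the relevant entries of the intersection table. [cite: MumfordAV1970, §16] -/
theorem sextic_independent_of_table {F : Type*} [Field F] [CharZero F] [Algebra F A] (T₁ T₂ v : A) (hv : v ≠ 0)
    (t330 : T₁ ^ 3 * T₂ ^ 3 = 36 * v)
    (g : Fin 1 → F) (hG : g 0 • (T₁ ^ 3 * T₂ ^ 3) = 0) :
    g 0 = 0 := by
  simp only [Algebra.smul_def] at hG
  have e0 : 36 * g 0 = 0 := by
    refine smul_vol_eq_zero (F := F) hv _ ?_
    have hm := congrArg (· * (1)) hG
    simp only [zero_mul] at hm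
    simp only [map_mul, map_ofNat]
    linear_combination hm + (-(algebraMap F A (g 0))) * t330
  linear_combination (1/36 : F) * e0

/-- Degree 6: `θ₁³θ₂³ ≠ 0` spans `Sub₆` — a scalar multiple `g·θ₁³θ₂³` vanishes only for `g = 0`. [cite: MumfordAV1970, §16] -/
theorem sextic_independent {F : Type*} [Field F] [CharZero F] [Algebra F A] (h : BlockRel) (hvol : vol ≠ 0)
    (g : Fin 1 → F) (hG : g 0 • (ϑ₁ ^ 3 * ϑ₂ ^ 3) = 0) :
    g 0 = 0 :=
  sextic_independent_of_table (F := F) ϑ₁ ϑ₂ vol hvol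
    (sextic_330 a b c h)
    g hG

/-- Abstract form of `quintics_independent` (next): elements `T₁, T₂, Q, v ≠ 0` of a commutative algebra over a field of
characteristic `0` satisfying the relevant entries of the intersection table. [cite: MumfordAV1970, §16] -/
theorem quintics_independent_of_table {F : Type*} [Field F] [CharZero F] [Algebra F A] (T₁ T₂ Q v : A) (hv : v ≠ 0)
    (t420 : T₁ ^ 4 * T₂ ^ 2 = 0)
    (t330 : T₁ ^ 3 * T₂ ^ 3 = 36 * v)
    (t321 : T₁ ^ 3 * T₂ ^ 2 * Q = 0)
    (t240 : T₁ ^ 2 * T₂ ^ 4 = 0)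
    (t231 : T₁ ^ 2 * T₂ ^ 3 * Q = 0)
    (t222 : T₁ ^ 2 * T₂ ^ 2 * Q ^ 2 = -(24 * v))
    (g : Fin 3 → F) (hG : g 0 • (T₁ ^ 3 * T₂ ^ 2) + g 1 • (T₁ ^ 2 * T₂ ^ 3) + g 2 • (T₁ ^ 2 * T₂ ^ 2 * Q) = 0) :
    g 0 = 0 ∧ g 1 = 0 ∧ g 2 = 0 := by
  simp only [Algebra.smul_def] at hG
  have e0 : 36 * g 0 = 0 := by
    refine smul_vol_eq_zero (F := F) hv _ ?_
    have hm := congrArg (· * (T₂)) hG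
    simp only [zero_mul] at hm
    simp only [map_mul, map_ofNat]
    linear_combination hm + (-(algebraMap F A (g 0))) * t330 + (-(algebraMap F A (g 1))) * t240 + (-(algebraMap F A (g 2))) * t231
  have e1 : 36 * g 1 = 0 := by
    refine smul_vol_eq_zero (F := F) hv _ ?_
    have hm := congrArg (· * (T₁)) hG
    simp only [zero_mul] at hm
    simp only [map_mul, map_ofNat]
    linear_combination hm + (-(algebraMap F A (g 0))) * t420 + (-(algebraMap F A (g 1))) * t330 + (-(algebraMap F A (g 2))) * t321
  have e2 : (-24) * g 2 = 0 := by
    refine smul_vol_eq_zero (F := F) hv _ ?_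
    have hm := congrArg (· * (Q)) hG
    simp only [zero_mul] at hm
    simp only [map_mul, map_neg, map_ofNat]
    linear_combination hm + (-(algebraMap F A (g 0))) * t321 + (-(algebraMap F A (g 1))) * t231 + (-(algebraMap F A (g 2))) * t222
  exact ⟨by linear_combination (1/36 : F) * e0, by linear_combination (1/36 : F) * e1, by linear_combination (-1/24 : F) * e2⟩

/-- Degree 5: `θ₁³θ₂², θ₁²θ₂³, θ₁²θ₂²P` are linearly independent in `H¹⁰(Y₀)` (dual monomials `θ₂, θ₁, P`). [cite: MumfordAV1970, §16] -/
theorem quintics_independent {F : Type*} [Field F] [CharZero F] [Algebra F A] (h : BlockRel) (hvol : vol ≠ 0)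
    (g : Fin 3 → F) (hG : g 0 • (ϑ₁ ^ 3 * ϑ₂ ^ 2) + g 1 • (ϑ₁ ^ 2 * ϑ₂ ^ 3) + g 2 • (ϑ₁ ^ 2 * ϑ₂ ^ 2 * 𝒫) = 0) :
    g 0 = 0 ∧ g 1 = 0 ∧ g 2 = 0 :=
  quintics_independent_of_table (F := F) ϑ₁ ϑ₂ 𝒫 vol hvol
    (sextic_420 a b c h) (sextic_330 a b c h) (sextic_321 a b c h) (sextic_240 a b c h) (sextic_231 a b c h) (sextic_222 a b c h)
    g hG

/-- Abstract form of `linears_independent` (next): elements `T₁, T₂, Q, v ≠ 0` of a commutative algebra over a field of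
characteristic `0` satisfying the relevant entries of the intersection table. [cite: MumfordAV1970, §16] -/
theorem linears_independent_of_table {F : Type*} [Field F] [CharZero F] [Algebra F A] (T₁ T₂ Q v : A) (hv : v ≠ 0)
    (t420 : T₁ ^ 4 * T₂ ^ 2 = 0)
    (t330 : T₁ ^ 3 * T₂ ^ 3 = 36 * v)
    (t321 : T₁ ^ 3 * T₂ ^ 2 * Q = 0)
    (t240 : T₁ ^ 2 * T₂ ^ 4 = 0)
    (t231 : T₁ ^ 2 * T₂ ^ 3 * Q = 0)
    (t222 : T₁ ^ 2 * T₂ ^ 2 * Q ^ 2 = -(24 * v))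
    (g : Fin 3 → F) (hG : g 0 • T₁ + g 1 • T₂ + g 2 • Q = 0) :
    g 0 = 0 ∧ g 1 = 0 ∧ g 2 = 0 := by
  simp only [Algebra.smul_def] at hG
  have e0 : 36 * g 0 = 0 := by
    refine smul_vol_eq_zero (F := F) hv _ ?_
    have hm := congrArg (· * (T₁ ^ 2 * T₂ ^ 3)) hG
    simp only [zero_mul] at hm
    simp only [map_mul, map_ofNat]
    linear_combination hm + (-(algebraMap F A (g 0))) * t330 + (-(algebraMap F A (g 1))) * t240 + (-(algebraMap F A (g 2))) * t231
  have e1 : 36 * g 1 = 0 := by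
    refine smul_vol_eq_zero (F := F) hv _ ?_
    have hm := congrArg (· * (T₁ ^ 3 * T₂ ^ 2)) hG
    simp only [zero_mul] at hm
    simp only [map_mul, map_ofNat]
    linear_combination hm + (-(algebraMap F A (g 0))) * t420 + (-(algebraMap F A (g 1))) * t330 + (-(algebraMap F A (g 2))) * t321
  have e2 : (-24) * g 2 = 0 := by
    refine smul_vol_eq_zero (F := F) hv _ ?_
    have hm := congrArg (· * (T₁ ^ 2 * T₂ ^ 2 * Q)) hG
    simp only [zero_mul] at hm
    simp only [map_mul, map_neg, map_ofNat]
    linear_combination hm + (-(algebraMap F A (g 0))) * t321 + (-(algebraMap F A (g 1))) * t231 + (-(algebraMap F A (g 2))) * t222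
  exact ⟨by linear_combination (1/36 : F) * e0, by linear_combination (1/36 : F) * e1, by linear_combination (-1/24 : F) * e2⟩

/-- Degree 1: `θ₁, θ₂, P` are linearly independent in `H²(Y₀)` (dual monomials `θ₁²θ₂³, θ₁³θ₂², θ₁²θ₂²P`). [cite: MumfordAV1970, §16] -/
theorem linears_independent {F : Type*} [Field F] [CharZero F] [Algebra F A] (h : BlockRel) (hvol : vol ≠ 0)
    (g : Fin 3 → F) (hG : g 0 • ϑ₁ + g 1 • ϑ₂ + g 2 • 𝒫 = 0) :
    g 0 = 0 ∧ g 1 = 0 ∧ g 2 = 0 :=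
  linears_independent_of_table (F := F) ϑ₁ ϑ₂ 𝒫 vol hvol
    (sextic_420 a b c h) (sextic_330 a b c h) (sextic_321 a b c h) (sextic_240 a b c h) (sextic_231 a b c h) (sextic_222 a b c h)
    g hG

/-- Abstract form of `quartics_independent` (next): elements `T₁, T₂, Q, v ≠ 0` of a commutative algebra over a field of
characteristic `0` satisfying the relevant entries of the intersection table. [cite: MumfordAV1970, §16] -/
theorem quartics_independent_of_table {F : Type*} [Field F] [CharZero F] [Algebra F A] (T₁ T₂ Q v : A) (hv : v ≠ 0)
    (t510 : T₁ ^ 5 * T₂ = 0)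
    (t420 : T₁ ^ 4 * T₂ ^ 2 = 0)
    (t411 : T₁ ^ 4 * T₂ * Q = 0)
    (t330 : T₁ ^ 3 * T₂ ^ 3 = 36 * v)
    (t321 : T₁ ^ 3 * T₂ ^ 2 * Q = 0)
    (t312 : T₁ ^ 3 * T₂ * Q ^ 2 = 0)
    (t240 : T₁ ^ 2 * T₂ ^ 4 = 0)
    (t231 : T₁ ^ 2 * T₂ ^ 3 * Q = 0)
    (t222 : T₁ ^ 2 * T₂ ^ 2 * Q ^ 2 = -(24 * v))
    (t213 : T₁ ^ 2 * T₂ * Q ^ 3 = 0)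
    (t150 : T₁ * T₂ ^ 5 = 0)
    (t141 : T₁ * T₂ ^ 4 * Q = 0)
    (t132 : T₁ * T₂ ^ 3 * Q ^ 2 = 0)
    (t123 : T₁ * T₂ ^ 2 * Q ^ 3 = 0)
    (t114 : T₁ * T₂ * Q ^ 4 = 72 * v)
    (g : Fin 6 → F) (hG : g 0 • (T₁ ^ 3 * T₂) + g 1 • (T₁ ^ 2 * T₂ ^ 2) + g 2 • (T₁ ^ 2 * T₂ * Q) + g 3 • (T₁ * T₂ ^ 3) + g 4 • (T₁ * T₂ ^ 2 * Q) + g 5 • (T₁ * T₂ * Q ^ 2) = 0) :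
    g 0 = 0 ∧ g 1 = 0 ∧ g 2 = 0 ∧ g 3 = 0 ∧ g 4 = 0 ∧ g 5 = 0 := by
  simp only [Algebra.smul_def] at hG
  have e0 : 36 * g 0 = 0 := by
    refine smul_vol_eq_zero (F := F) hv _ ?_
    have hm := congrArg (· * (T₂ ^ 2)) hG
    simp only [zero_mul] at hm
    simp only [map_mul, map_ofNat]
    linear_combination hm + (-(algebraMap F A (g 0))) * t330 + (-(algebraMap F A (g 1))) * t240 + (-(algebraMap F A (g 2))) * t231 + (-(algebraMap F A (g 3))) * t150 + (-(algebraMap F A (g 4))) * t141 + (-(algebraMap F A (g 5))) * t132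
  have e1 : 36 * g 1 + (-24) * g 5 = 0 := by
    refine smul_vol_eq_zero (F := F) hv _ ?_
    have hm := congrArg (· * (T₁ * T₂)) hG
    simp only [zero_mul] at hm
    simp only [map_add, map_mul, map_neg, map_ofNat]
    linear_combination hm + (-(algebraMap F A (g 0))) * t420 + (-(algebraMap F A (g 1))) * t330 + (-(algebraMap F A (g 2))) * t321 + (-(algebraMap F A (g 3))) * t240 + (-(algebraMap F A (g 4))) * t231 + (-(algebraMap F A (g 5))) * t222
  have e2 : (-24) * g 2 = 0 := by
    refine smul_vol_eq_zero (F := F) hv _ ?_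
    have hm := congrArg (· * (T₂ * Q)) hG
    simp only [zero_mul] at hm
    simp only [map_mul, map_neg, map_ofNat]
    linear_combination hm + (-(algebraMap F A (g 0))) * t321 + (-(algebraMap F A (g 1))) * t231 + (-(algebraMap F A (g 2))) * t222 + (-(algebraMap F A (g 3))) * t141 + (-(algebraMap F A (g 4))) * t132 + (-(algebraMap F A (g 5))) * t123
  have e3 : 36 * g 3 = 0 := by
    refine smul_vol_eq_zero (F := F) hv _ ?_
    have hm := congrArg (· * (T₁ ^ 2)) hG
    simp only [zero_mul] at hm
    simp only [map_mul, map_ofNat]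
    linear_combination hm + (-(algebraMap F A (g 0))) * t510 + (-(algebraMap F A (g 1))) * t420 + (-(algebraMap F A (g 2))) * t411 + (-(algebraMap F A (g 3))) * t330 + (-(algebraMap F A (g 4))) * t321 + (-(algebraMap F A (g 5))) * t312
  have e4 : (-24) * g 4 = 0 := by
    refine smul_vol_eq_zero (F := F) hv _ ?_
    have hm := congrArg (· * (T₁ * Q)) hG
    simp only [zero_mul] at hm
    simp only [map_mul, map_neg, map_ofNat]
    linear_combination hm + (-(algebraMap F A (g 0))) * t411 + (-(algebraMap F A (g 1))) * t321 + (-(algebraMap F A (g 2))) * t312 + (-(algebraMap F A (g 3))) * t231 + (-(algebraMap F A (g 4))) * t222 + (-(algebraMap F A (g 5))) * t213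
  have e5 : (-24) * g 1 + 72 * g 5 = 0 := by
    refine smul_vol_eq_zero (F := F) hv _ ?_
    have hm := congrArg (· * (Q ^ 2)) hG
    simp only [zero_mul] at hm
    simp only [map_add, map_mul, map_neg, map_ofNat]
    linear_combination hm + (-(algebraMap F A (g 0))) * t312 + (-(algebraMap F A (g 1))) * t222 + (-(algebraMap F A (g 2))) * t213 + (-(algebraMap F A (g 3))) * t132 + (-(algebraMap F A (g 4))) * t123 + (-(algebraMap F A (g 5))) * t114
  exact ⟨by linear_combination (1/36 : F) * e0, by linear_combination (1/28 : F) * e1 + (1/84 : F) * e5, by linear_combination (-1/24 : F) * e2, by linear_combination (1/36 : F) * e3, by linear_combination (-1/24 : F) * e4, by linear_combination (1/84 : F) * e1 + (1/56 : F) * e5⟩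

/-- Degree 4: `θ₁³θ₂, θ₁²θ₂², θ₁²θ₂P, θ₁θ₂³, θ₁θ₂²P, θ₁θ₂P²` are linearly independent in `H⁸(Y₀)` — with §3 they form a basis of `Sub₄` (dual quadrics `θ₂², θ₁θ₂, θ₂P, θ₁², θ₁P, P²`; the `6 × 6` pairing `Sub₄ × Sub₂` is non-singular, so `u ∈ Sub₄` is zero iff `∫u·v = 0` for all quadrics `v`). [cite: MumfordAV1970, §16] -/
theorem quartics_independent {F : Type*} [Field F] [CharZero F] [Algebra F A] (h : BlockRel) (hvol : vol ≠ 0)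
    (g : Fin 6 → F) (hG : g 0 • (ϑ₁ ^ 3 * ϑ₂) + g 1 • (ϑ₁ ^ 2 * ϑ₂ ^ 2) + g 2 • (ϑ₁ ^ 2 * ϑ₂ * 𝒫) + g 3 • (ϑ₁ * ϑ₂ ^ 3) + g 4 • (ϑ₁ * ϑ₂ ^ 2 * 𝒫) + g 5 • (ϑ₁ * ϑ₂ * 𝒫 ^ 2) = 0) :
    g 0 = 0 ∧ g 1 = 0 ∧ g 2 = 0 ∧ g 3 = 0 ∧ g 4 = 0 ∧ g 5 = 0 :=
  quartics_independent_of_table (F := F) ϑ₁ ϑ₂ 𝒫 vol hvol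
    (sextic_510 a b c h) (sextic_420 a b c h) (sextic_411 a b c h) (sextic_330 a b c h) (sextic_321 a b c h) (sextic_312 a b c h) (sextic_240 a b c h) (sextic_231 a b c h) (sextic_222 a b c h) (sextic_213 a b c h) (sextic_150 a b c h) (sextic_141 a b c h) (sextic_132 a b c h) (sextic_123 a b c h) (sextic_114 a b c h)
    g hG

/-- Abstract form of `quadrics_independent` (next): elements `T₁, T₂, Q, v ≠ 0` of a commutative algebra over a field of
characteristic `0` satisfying the relevant entries of the intersection table. [cite: MumfordAV1970, §16] -/
theorem quadrics_independent_of_table {F : Type*} [Field F] [CharZero F] [Algebra F A] (T₁ T₂ Q v : A) (hv : v ≠ 0)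
    (t510 : T₁ ^ 5 * T₂ = 0)
    (t420 : T₁ ^ 4 * T₂ ^ 2 = 0)
    (t411 : T₁ ^ 4 * T₂ * Q = 0)
    (t330 : T₁ ^ 3 * T₂ ^ 3 = 36 * v)
    (t321 : T₁ ^ 3 * T₂ ^ 2 * Q = 0)
    (t312 : T₁ ^ 3 * T₂ * Q ^ 2 = 0)
    (t240 : T₁ ^ 2 * T₂ ^ 4 = 0)
    (t231 : T₁ ^ 2 * T₂ ^ 3 * Q = 0)
    (t222 : T₁ ^ 2 * T₂ ^ 2 * Q ^ 2 = -(24 * v))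
    (t213 : T₁ ^ 2 * T₂ * Q ^ 3 = 0)
    (t150 : T₁ * T₂ ^ 5 = 0)
    (t141 : T₁ * T₂ ^ 4 * Q = 0)
    (t132 : T₁ * T₂ ^ 3 * Q ^ 2 = 0)
    (t123 : T₁ * T₂ ^ 2 * Q ^ 3 = 0)
    (t114 : T₁ * T₂ * Q ^ 4 = 72 * v)
    (g : Fin 6 → F) (hG : g 0 • (T₁ ^ 2) + g 1 • (T₁ * T₂) + g 2 • (T₁ * Q) + g 3 • (T₂ ^ 2) + g 4 • (T₂ * Q) + g 5 • (Q ^ 2) = 0) :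
    g 0 = 0 ∧ g 1 = 0 ∧ g 2 = 0 ∧ g 3 = 0 ∧ g 4 = 0 ∧ g 5 = 0 := by
  simp only [Algebra.smul_def] at hG
  have e0 : 36 * g 0 = 0 := by
    refine smul_vol_eq_zero (F := F) hv _ ?_
    have hm := congrArg (· * (T₁ * T₂ ^ 3)) hG
    simp only [zero_mul] at hm
    simp only [map_mul, map_ofNat]
    linear_combination hm + (-(algebraMap F A (g 0))) * t330 + (-(algebraMap F A (g 1))) * t240 + (-(algebraMap F A (g 2))) * t231 + (-(algebraMap F A (g 3))) * t150 + (-(algebraMap F A (g 4))) * t141 + (-(algebraMap F A (g 5))) * t132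
  have e1 : 36 * g 1 + (-24) * g 5 = 0 := by
    refine smul_vol_eq_zero (F := F) hv _ ?_
    have hm := congrArg (· * (T₁ ^ 2 * T₂ ^ 2)) hG
    simp only [zero_mul] at hm
    simp only [map_add, map_mul, map_neg, map_ofNat]
    linear_combination hm + (-(algebraMap F A (g 0))) * t420 + (-(algebraMap F A (g 1))) * t330 + (-(algebraMap F A (g 2))) * t321 + (-(algebraMap F A (g 3))) * t240 + (-(algebraMap F A (g 4))) * t231 + (-(algebraMap F A (g 5))) * t222
  have e2 : (-24) * g 2 = 0 := by
    refine smul_vol_eq_zero (F := F) hv _ ?_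
    have hm := congrArg (· * (T₁ * T₂ ^ 2 * Q)) hG
    simp only [zero_mul] at hm
    simp only [map_mul, map_neg, map_ofNat]
    linear_combination hm + (-(algebraMap F A (g 0))) * t321 + (-(algebraMap F A (g 1))) * t231 + (-(algebraMap F A (g 2))) * t222 + (-(algebraMap F A (g 3))) * t141 + (-(algebraMap F A (g 4))) * t132 + (-(algebraMap F A (g 5))) * t123
  have e3 : 36 * g 3 = 0 := by
    refine smul_vol_eq_zero (F := F) hv _ ?_
    have hm := congrArg (· * (T₁ ^ 3 * T₂)) hG
    simp only [zero_mul] at hm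
    simp only [map_mul, map_ofNat]
    linear_combination hm + (-(algebraMap F A (g 0))) * t510 + (-(algebraMap F A (g 1))) * t420 + (-(algebraMap F A (g 2))) * t411 + (-(algebraMap F A (g 3))) * t330 + (-(algebraMap F A (g 4))) * t321 + (-(algebraMap F A (g 5))) * t312
  have e4 : (-24) * g 4 = 0 := by
    refine smul_vol_eq_zero (F := F) hv _ ?_
    have hm := congrArg (· * (T₁ ^ 2 * T₂ * Q)) hG
    simp only [zero_mul] at hm
    simp only [map_mul, map_neg, map_ofNat]
    linear_combination hm + (-(algebraMap F A (g 0))) * t411 + (-(algebraMap F A (g 1))) * t321 + (-(algebraMap F A (g 2))) * t312 + (-(algebraMap F A (g 3))) * t231 + (-(algebraMap F A (g 4))) * t222 + (-(algebraMap F A (g 5))) * t213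
  have e5 : (-24) * g 1 + 72 * g 5 = 0 := by
    refine smul_vol_eq_zero (F := F) hv _ ?_
    have hm := congrArg (· * (T₁ * T₂ * Q ^ 2)) hG
    simp only [zero_mul] at hm
    simp only [map_add, map_mul, map_neg, map_ofNat]
    linear_combination hm + (-(algebraMap F A (g 0))) * t312 + (-(algebraMap F A (g 1))) * t222 + (-(algebraMap F A (g 2))) * t213 + (-(algebraMap F A (g 3))) * t132 + (-(algebraMap F A (g 4))) * t123 + (-(algebraMap F A (g 5))) * t114
  exact ⟨by linear_combination (1/36 : F) * e0, by linear_combination (1/28 : F) * e1 + (1/84 : F) * e5, by linear_combination (-1/24 : F) * e2, by linear_combination (1/36 : F) * e3, by linear_combination (-1/24 : F) * e4, by linear_combination (1/84 : F) * e1 + (1/56 : F) * e5⟩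

/-- Degree 2: `θ₁², θ₁θ₂, θ₁P, θ₂², θ₂P, P²` are linearly independent in `H⁴(Y₀)`: `Sym² NS_ℚ ↪ H⁴` (dual quartics `θ₁θ₂³, θ₁²θ₂², θ₁θ₂²P, θ₁³θ₂, θ₁²θ₂P, θ₁θ₂P²`). [cite: MumfordAV1970, §16] -/
theorem quadrics_independent {F : Type*} [Field F] [CharZero F] [Algebra F A] (h : BlockRel) (hvol : vol ≠ 0)
    (g : Fin 6 → F) (hG : g 0 • (ϑ₁ ^ 2) + g 1 • (ϑ₁ * ϑ₂) + g 2 • (ϑ₁ * 𝒫) + g 3 • (ϑ₂ ^ 2) + g 4 • (ϑ₂ * 𝒫) + g 5 • (𝒫 ^ 2) = 0) :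
    g 0 = 0 ∧ g 1 = 0 ∧ g 2 = 0 ∧ g 3 = 0 ∧ g 4 = 0 ∧ g 5 = 0 :=
  quadrics_independent_of_table (F := F) ϑ₁ ϑ₂ 𝒫 vol hvol
    (sextic_510 a b c h) (sextic_420 a b c h) (sextic_411 a b c h) (sextic_330 a b c h) (sextic_321 a b c h) (sextic_312 a b c h) (sextic_240 a b c h) (sextic_231 a b c h) (sextic_222 a b c h) (sextic_213 a b c h) (sextic_150 a b c h) (sextic_141 a b c h) (sextic_132 a b c h) (sextic_123 a b c h) (sextic_114 a b c h)
    g hG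

/-- Abstract form of `cubics_independent` (next): elements `T₁, T₂, Q, v ≠ 0` of a commutative algebra over a field of
characteristic `0` satisfying the relevant entries of the intersection table. [cite: MumfordAV1970, §16] -/
theorem cubics_independent_of_table {F : Type*} [Field F] [CharZero F] [Algebra F A] (T₁ T₂ Q v : A) (hv : v ≠ 0)
    (t600 : T₁ ^ 6 = 0)
    (t510 : T₁ ^ 5 * T₂ = 0)
    (t501 : T₁ ^ 5 * Q = 0)
    (t420 : T₁ ^ 4 * T₂ ^ 2 = 0)
    (t411 : T₁ ^ 4 * T₂ * Q = 0)
    (t402 : T₁ ^ 4 * Q ^ 2 = 0)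
    (t330 : T₁ ^ 3 * T₂ ^ 3 = 36 * v)
    (t321 : T₁ ^ 3 * T₂ ^ 2 * Q = 0)
    (t312 : T₁ ^ 3 * T₂ * Q ^ 2 = 0)
    (t303 : T₁ ^ 3 * Q ^ 3 = 0)
    (t240 : T₁ ^ 2 * T₂ ^ 4 = 0)
    (t231 : T₁ ^ 2 * T₂ ^ 3 * Q = 0)
    (t222 : T₁ ^ 2 * T₂ ^ 2 * Q ^ 2 = -(24 * v))
    (t213 : T₁ ^ 2 * T₂ * Q ^ 3 = 0)
    (t204 : T₁ ^ 2 * Q ^ 4 = 0)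
    (t150 : T₁ * T₂ ^ 5 = 0)
    (t141 : T₁ * T₂ ^ 4 * Q = 0)
    (t132 : T₁ * T₂ ^ 3 * Q ^ 2 = 0)
    (t123 : T₁ * T₂ ^ 2 * Q ^ 3 = 0)
    (t114 : T₁ * T₂ * Q ^ 4 = 72 * v)
    (t105 : T₁ * Q ^ 5 = 0)
    (t060 : T₂ ^ 6 = 0)
    (t051 : T₂ ^ 5 * Q = 0)
    (t042 : T₂ ^ 4 * Q ^ 2 = 0)
    (t033 : T₂ ^ 3 * Q ^ 3 = 0)
    (t024 : T₂ ^ 2 * Q ^ 4 = 0)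
    (t015 : T₂ * Q ^ 5 = 0)
    (t006 : Q ^ 6 = -(720 * v))
    (g : Fin 10 → F) (hG : g 0 • (T₁ ^ 3) + g 1 • (T₁ ^ 2 * T₂) + g 2 • (T₁ ^ 2 * Q) + g 3 • (T₁ * T₂ ^ 2) + g 4 • (T₁ * T₂ * Q) + g 5 • (T₁ * Q ^ 2) + g 6 • (T₂ ^ 3) + g 7 • (T₂ ^ 2 * Q) + g 8 • (T₂ * Q ^ 2) + g 9 • (Q ^ 3) = 0) :
    g 0 = 0 ∧ g 1 = 0 ∧ g 2 = 0 ∧ g 3 = 0 ∧ g 4 = 0 ∧ g 5 = 0 ∧ g 6 = 0 ∧ g 7 = 0 ∧ g 8 = 0 ∧ g 9 = 0 := by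
  simp only [Algebra.smul_def] at hG
  have e0 : 36 * g 6 = 0 := by
    refine smul_vol_eq_zero (F := F) hv _ ?_
    have hm := congrArg (· * (T₁ ^ 3)) hG
    simp only [zero_mul] at hm
    simp only [map_mul, map_ofNat]
    linear_combination hm + (-(algebraMap F A (g 0))) * t600 + (-(algebraMap F A (g 1))) * t510 + (-(algebraMap F A (g 2))) * t501 + (-(algebraMap F A (g 3))) * t420 + (-(algebraMap F A (g 4))) * t411 + (-(algebraMap F A (g 5))) * t402 + (-(algebraMap F A (g 6))) * t330 + (-(algebraMap F A (g 7))) * t321 + (-(algebraMap F A (g 8))) * t312 + (-(algebraMap F A (g 9))) * t303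
  have e1 : 36 * g 3 + (-24) * g 8 = 0 := by
    refine smul_vol_eq_zero (F := F) hv _ ?_
    have hm := congrArg (· * (T₁ ^ 2 * T₂)) hG
    simp only [zero_mul] at hm
    simp only [map_add, map_mul, map_neg, map_ofNat]
    linear_combination hm + (-(algebraMap F A (g 0))) * t510 + (-(algebraMap F A (g 1))) * t420 + (-(algebraMap F A (g 2))) * t411 + (-(algebraMap F A (g 3))) * t330 + (-(algebraMap F A (g 4))) * t321 + (-(algebraMap F A (g 5))) * t312 + (-(algebraMap F A (g 6))) * t240 + (-(algebraMap F A (g 7))) * t231 + (-(algebraMap F A (g 8))) * t222 + (-(algebraMap F A (g 9))) * t213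
  have e2 : (-24) * g 7 = 0 := by
    refine smul_vol_eq_zero (F := F) hv _ ?_
    have hm := congrArg (· * (T₁ ^ 2 * Q)) hG
    simp only [zero_mul] at hm
    simp only [map_mul, map_neg, map_ofNat]
    linear_combination hm + (-(algebraMap F A (g 0))) * t501 + (-(algebraMap F A (g 1))) * t411 + (-(algebraMap F A (g 2))) * t402 + (-(algebraMap F A (g 3))) * t321 + (-(algebraMap F A (g 4))) * t312 + (-(algebraMap F A (g 5))) * t303 + (-(algebraMap F A (g 6))) * t231 + (-(algebraMap F A (g 7))) * t222 + (-(algebraMap F A (g 8))) * t213 + (-(algebraMap F A (g 9))) * t204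
  have e3 : 36 * g 1 + (-24) * g 5 = 0 := by
    refine smul_vol_eq_zero (F := F) hv _ ?_
    have hm := congrArg (· * (T₁ * T₂ ^ 2)) hG
    simp only [zero_mul] at hm
    simp only [map_add, map_mul, map_neg, map_ofNat]
    linear_combination hm + (-(algebraMap F A (g 0))) * t420 + (-(algebraMap F A (g 1))) * t330 + (-(algebraMap F A (g 2))) * t321 + (-(algebraMap F A (g 3))) * t240 + (-(algebraMap F A (g 4))) * t231 + (-(algebraMap F A (g 5))) * t222 + (-(algebraMap F A (g 6))) * t150 + (-(algebraMap F A (g 7))) * t141 + (-(algebraMap F A (g 8))) * t132 + (-(algebraMap F A (g 9))) * t123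
  have e4 : (-24) * g 4 + 72 * g 9 = 0 := by
    refine smul_vol_eq_zero (F := F) hv _ ?_
    have hm := congrArg (· * (T₁ * T₂ * Q)) hG
    simp only [zero_mul] at hm
    simp only [map_add, map_mul, map_neg, map_ofNat]
    linear_combination hm + (-(algebraMap F A (g 0))) * t411 + (-(algebraMap F A (g 1))) * t321 + (-(algebraMap F A (g 2))) * t312 + (-(algebraMap F A (g 3))) * t231 + (-(algebraMap F A (g 4))) * t222 + (-(algebraMap F A (g 5))) * t213 + (-(algebraMap F A (g 6))) * t141 + (-(algebraMap F A (g 7))) * t132 + (-(algebraMap F A (g 8))) * t123 + (-(algebraMap F A (g 9))) * t114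
  have e5 : (-24) * g 3 + 72 * g 8 = 0 := by
    refine smul_vol_eq_zero (F := F) hv _ ?_
    have hm := congrArg (· * (T₁ * Q ^ 2)) hG
    simp only [zero_mul] at hm
    simp only [map_add, map_mul, map_neg, map_ofNat]
    linear_combination hm + (-(algebraMap F A (g 0))) * t402 + (-(algebraMap F A (g 1))) * t312 + (-(algebraMap F A (g 2))) * t303 + (-(algebraMap F A (g 3))) * t222 + (-(algebraMap F A (g 4))) * t213 + (-(algebraMap F A (g 5))) * t204 + (-(algebraMap F A (g 6))) * t132 + (-(algebraMap F A (g 7))) * t123 + (-(algebraMap F A (g 8))) * t114 + (-(algebraMap F A (g 9))) * t105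
  have e6 : 36 * g 0 = 0 := by
    refine smul_vol_eq_zero (F := F) hv _ ?_
    have hm := congrArg (· * (T₂ ^ 3)) hG
    simp only [zero_mul] at hm
    simp only [map_mul, map_ofNat]
    linear_combination hm + (-(algebraMap F A (g 0))) * t330 + (-(algebraMap F A (g 1))) * t240 + (-(algebraMap F A (g 2))) * t231 + (-(algebraMap F A (g 3))) * t150 + (-(algebraMap F A (g 4))) * t141 + (-(algebraMap F A (g 5))) * t132 + (-(algebraMap F A (g 6))) * t060 + (-(algebraMap F A (g 7))) * t051 + (-(algebraMap F A (g 8))) * t042 + (-(algebraMap F A (g 9))) * t033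
  have e7 : (-24) * g 2 = 0 := by
    refine smul_vol_eq_zero (F := F) hv _ ?_
    have hm := congrArg (· * (T₂ ^ 2 * Q)) hG
    simp only [zero_mul] at hm
    simp only [map_mul, map_neg, map_ofNat]
    linear_combination hm + (-(algebraMap F A (g 0))) * t321 + (-(algebraMap F A (g 1))) * t231 + (-(algebraMap F A (g 2))) * t222 + (-(algebraMap F A (g 3))) * t141 + (-(algebraMap F A (g 4))) * t132 + (-(algebraMap F A (g 5))) * t123 + (-(algebraMap F A (g 6))) * t051 + (-(algebraMap F A (g 7))) * t042 + (-(algebraMap F A (g 8))) * t033 + (-(algebraMap F A (g 9))) * t024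
  have e8 : (-24) * g 1 + 72 * g 5 = 0 := by
    refine smul_vol_eq_zero (F := F) hv _ ?_
    have hm := congrArg (· * (T₂ * Q ^ 2)) hG
    simp only [zero_mul] at hm
    simp only [map_add, map_mul, map_neg, map_ofNat]
    linear_combination hm + (-(algebraMap F A (g 0))) * t312 + (-(algebraMap F A (g 1))) * t222 + (-(algebraMap F A (g 2))) * t213 + (-(algebraMap F A (g 3))) * t132 + (-(algebraMap F A (g 4))) * t123 + (-(algebraMap F A (g 5))) * t114 + (-(algebraMap F A (g 6))) * t042 + (-(algebraMap F A (g 7))) * t033 + (-(algebraMap F A (g 8))) * t024 + (-(algebraMap F A (g 9))) * t015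
  have e9 : 72 * g 4 + (-720) * g 9 = 0 := by
    refine smul_vol_eq_zero (F := F) hv _ ?_
    have hm := congrArg (· * (Q ^ 3)) hG
    simp only [zero_mul] at hm
    simp only [map_add, map_mul, map_neg, map_ofNat]
    linear_combination hm + (-(algebraMap F A (g 0))) * t303 + (-(algebraMap F A (g 1))) * t213 + (-(algebraMap F A (g 2))) * t204 + (-(algebraMap F A (g 3))) * t123 + (-(algebraMap F A (g 4))) * t114 + (-(algebraMap F A (g 5))) * t105 + (-(algebraMap F A (g 6))) * t033 + (-(algebraMap F A (g 7))) * t024 + (-(algebraMap F A (g 8))) * t015 + (-(algebraMap F A (g 9))) * t006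
  exact ⟨by linear_combination (1/36 : F) * e6, by linear_combination (1/28 : F) * e3 + (1/84 : F) * e8, by linear_combination (-1/24 : F) * e7, by linear_combination (1/28 : F) * e1 + (1/84 : F) * e5, by linear_combination (-5/84 : F) * e4 + (-1/168 : F) * e9, by linear_combination (1/84 : F) * e3 + (1/56 : F) * e8, by linear_combination (1/36 : F) * e0, by linear_combination (-1/24 : F) * e2, by linear_combination (1/84 : F) * e1 + (1/56 : F) * e5, by linear_combination (-1/168 : F) * e4 + (-1/504 : F) * e9⟩

/-- **Degree 3: all ten cubic monomials in `θ₁, θ₂, P` are linearly independent in `H⁶(Y₀)` — `Sym³ NS_ℚ ↪ H⁶(Y₀; ℚ)` has rank 10**, the exact-rank statement behind (T) "`Sym³NS ≅ B³`, a degree-6 Hodge class is a UNIQUE cubic form" of `WeilClassTestSplitDesigns.lean` and `WeilClassTestPairedDesign.lean` (dual monomials: the ten cubics themselves; the Gram matrix is block-diagonal for the grading `deg_{θ₁} − deg_{θ₂}`). [cite: MumfordAV1970, §16] -/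
theorem cubics_independent {F : Type*} [Field F] [CharZero F] [Algebra F A] (h : BlockRel) (hvol : vol ≠ 0)
    (g : Fin 10 → F) (hG : g 0 • (ϑ₁ ^ 3) + g 1 • (ϑ₁ ^ 2 * ϑ₂) + g 2 • (ϑ₁ ^ 2 * 𝒫) + g 3 • (ϑ₁ * ϑ₂ ^ 2) + g 4 • (ϑ₁ * ϑ₂ * 𝒫) + g 5 • (ϑ₁ * 𝒫 ^ 2) + g 6 • (ϑ₂ ^ 3) + g 7 • (ϑ₂ ^ 2 * 𝒫) + g 8 • (ϑ₂ * 𝒫 ^ 2) + g 9 • (𝒫 ^ 3) = 0) :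
    g 0 = 0 ∧ g 1 = 0 ∧ g 2 = 0 ∧ g 3 = 0 ∧ g 4 = 0 ∧ g 5 = 0 ∧ g 6 = 0 ∧ g 7 = 0 ∧ g 8 = 0 ∧ g 9 = 0 :=
  cubics_independent_of_table (F := F) ϑ₁ ϑ₂ 𝒫 vol hvol
    (sextic_600 a b c h) (sextic_510 a b c h) (sextic_501 a b c h) (sextic_420 a b c h) (sextic_411 a b c h) (sextic_402 a b c h) (sextic_330 a b c h) (sextic_321 a b c h) (sextic_312 a b c h) (sextic_303 a b c h) (sextic_240 a b c h) (sextic_231 a b c h) (sextic_222 a b c h) (sextic_213 a b c h) (sextic_204 a b c h) (sextic_150 a b c h) (sextic_141 a b c h) (sextic_132 a b c h) (sextic_123 a b c h) (sextic_114 a b c h) (sextic_105 a b c h) (sextic_060 a b c h) (sextic_051 a b c h) (sextic_042 a b c h) (sextic_033 a b c h) (sextic_024 a b c h) (sextic_015 a b c h) (sextic_006 a b c h)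
    g hG

end Rank

end Literature.AlgebraicGeometry.HodgeTheory.WeilClassTestTensorPointRingRank
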